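import Summits.Ventures.DiscreteObjects.UnitDistance.FieldPlanesCriterion

/-!
# Forbidding many distances at once: all `√q`, `q` a 2-adic unit (cell `pub-namedobj`, target (U), seat udg g11)

Framing (verbatim for the cell): lottery ticket; floor = certified bounds/negative ranges.

Johnson-type strengthening of the 2-adic criterion (cf. the titles of Johnson 1987/1990, "two-colourings … that forbid many
distances"; unread — statement and proof here are ours as far as searched, PROVISIONAL).  In a step frame of `ℚ₂(i, √2, √3)`
(`TwoAdicFrames`) call `u = X + I·Y` a `q`-STEP if `X² + Y² = q` with `q ∈ ℚ₂`, `‖q‖₂ = 1` (e.g. `q = r ∈ ℚ` with odd numerator and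
denominator).  Exactly as for unit steps: `‖u‖ = 1` (`u·αu = q`), `ū³ = 1` (via `τ` and `Zeta8Residues`), and in the RAMIFIED
frames `ū = 1` (because `q ≡ 1`, `θ̄² ≠ 1`, `θ̄⁴ ≠ 1`).  Consequently, for `S` in a ramified 2-adic pattern ONE `2`-colouring of
`K_S²` (the 2-adic parity) forbids SIMULTANEOUSLY every distance `√r`, `r ∈ ℚ_{>0}` with odd numerator and denominator
(`colorable_two_of_oddSquareDistances`); and for every `[−1]`-free `S` four colours forbid all of them at once
(`colorable_four_of_oddSquareDistances`).  Special case `r = 1` = the criterion of `MultiquadraticCriterion`; `S = ∅`: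
Woodall-type colourings of `ℚ²` forbidding all distances `√(odd/odd)`.  Nothing here is literature.
-/

noncomputable section

namespace Summit.Ventures.DiscreteObjects.UnitDistance

namespace MoserLocal

open Spectral SimpleGraph

variable {Ω : Type*} [Field Ω] [CharZero Ω] [Algebra ℚ_[2] Ω] [Algebra.IsAlgebraic ℚ_[2] Ω]
variable {D : LocalData23 Ω} (F : D.Frame)

/-- `q`-STEPS of a frame: `u = (A + B g₂) + I (C + E g₂)`, `A, B, C, E ∈ ℚ₂ ⊕ ℚ₂ g₁`, with `(A + B g₂)² + (C + E g₂)² = q`. -/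
def LocalData23.Frame.stepsQ (q : ℚ_[2]) : Set Ω :=
  {u | ∃ a b c d e f g h : ℚ_[2],
    u = ((algebraMap ℚ_[2] Ω a + algebraMap ℚ_[2] Ω b * F.g₁) + (algebraMap ℚ_[2] Ω c + algebraMap ℚ_[2] Ω d * F.g₁) * F.g₂)
      + D.I * ((algebraMap ℚ_[2] Ω e + algebraMap ℚ_[2] Ω f * F.g₁) + (algebraMap ℚ_[2] Ω g + algebraMap ℚ_[2] Ω h * F.g₁) * F.g₂) ∧
    ((algebraMap ℚ_[2] Ω a + algebraMap ℚ_[2] Ω b * F.g₁) + (algebraMap ℚ_[2] Ω c + algebraMap ℚ_[2] Ω d * F.g₁) * F.g₂) ^ 2 +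
      ((algebraMap ℚ_[2] Ω e + algebraMap ℚ_[2] Ω f * F.g₁) + (algebraMap ℚ_[2] Ω g + algebraMap ℚ_[2] Ω h * F.g₁) * F.g₂) ^ 2 =
        algebraMap ℚ_[2] Ω q}

omit [CharZero Ω] [Algebra.IsAlgebraic ℚ_[2] Ω] in
/-- Hermitian identity for `q`-steps: `u · αu = q`. -/
theorem LocalData23.Frame.mul_α_of_stepsQ {q : ℚ_[2]} {u : Ω} (hu : u ∈ F.stepsQ q) :
    u * F.α u = algebraMap ℚ_[2] Ω q := by
  obtain ⟨a, b, c, d, e, f, g, h, rfl, hq⟩ := hu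
  set A := algebraMap ℚ_[2] Ω a + algebraMap ℚ_[2] Ω b * F.g₁ with hA
  set B := algebraMap ℚ_[2] Ω c + algebraMap ℚ_[2] Ω d * F.g₁ with hB
  set C := algebraMap ℚ_[2] Ω e + algebraMap ℚ_[2] Ω f * F.g₁ with hC
  set E := algebraMap ℚ_[2] Ω g + algebraMap ℚ_[2] Ω h * F.g₁ with hE
  have hα : F.α ((A + B * F.g₂) + D.I * (C + E * F.g₂)) = (A + B * F.g₂) - D.I * (C + E * F.g₂) := by
    simp only [hA, hB, hC, hE, map_add, map_mul, AlgEquiv.commutes, F.αI, F.αg₁, F.αg₂]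
    ring
  rw [hα]; linear_combination hq + (-((C + E * F.g₂) ^ 2)) * D.hI

omit [CharZero Ω] in
/-- A `q`-step with `‖q‖ = 1` has norm `1`. -/
theorem LocalData23.Frame.spN_stepQ {q : ℚ_[2]} (hq : ‖q‖ = 1) {u : Ω} (hu : u ∈ F.stepsQ q) : spN ℚ_[2] u = 1 := by
  have hn := congrArg (spN ℚ_[2]) (F.mul_α_of_stepsQ hu)
  rw [spN_mul, spN_aut, spN_algebraMap, hq] at hn
  have h0 := spN_nonneg ℚ_[2] u
  nlinarith [hn, h0]

/-- GENERAL CUBE LEMMA: if `‖u‖ = 1` and both `u + τu` and `u·τu` lie in `V₈ = ℚ₂ ⊕ ℚ₂ s2 ⊕ ℚ₂ I ⊕ ℚ₂ s2 I`, then `ū³ = 1`. -/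
theorem cube_of_tau_data {u : Ω} (hu1 : spN ℚ_[2] u = 1) (hTv : D.InV8 (u + D.τ u)) (hNv : D.InV8 (u * D.τ u)) :
    resid ℚ_[2] Ω ⟨u, by rw [mem_ball_iff, hu1]⟩ ^ 3 = 1 := by
  have hmem : u ∈ ball ℚ_[2] Ω := by rw [mem_ball_iff, hu1]
  have hnτ : spN ℚ_[2] (D.τ u) = 1 := by rw [spN_aut]; exact hu1
  have hT_le : spN ℚ_[2] (u + D.τ u) ≤ 1 := (spN_add_le ℚ_[2] _ _).trans (max_le hu1.le hnτ.le)
  have hN_one : spN ℚ_[2] (u * D.τ u) = 1 := by rw [spN_mul, hu1, hnτ, mul_one]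
  have hTmem : u + D.τ u ∈ ball ℚ_[2] Ω := hT_le
  have hNmem : u * D.τ u ∈ ball ℚ_[2] Ω := by rw [mem_ball_iff, hN_one]
  set ub : ball ℚ_[2] Ω := ⟨u, hmem⟩ with hub
  set Tb : ball ℚ_[2] Ω := ⟨u + D.τ u, hTmem⟩ with hTb
  set Nb : ball ℚ_[2] Ω := ⟨u * D.τ u, hNmem⟩ with hNb
  have hrel : ub ^ 2 - Tb * ub + Nb = 0 := by
    apply Subtype.ext
    change u ^ 2 - (u + D.τ u) * u + u * D.τ u = (0 : Ω)
    ring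
  have hT01 := hTv.resid_zero_or_one hTmem
  have hN01 := hNv.resid_zero_or_one hNmem
  have hN1 : resid ℚ_[2] Ω Nb = 1 := by
    rcases hN01 with h0 | h1
    · exact absurd h0 (resid_ne_zero_of_spN_eq_one ℚ_[2] hN_one)
    · exact h1
  have key := congrArg (resid ℚ_[2] Ω) hrel
  rw [map_add, map_sub, map_mul, map_pow, map_zero, hN1] at key
  set x := resid ℚ_[2] Ω ub with hx
  rcases hT01 with h0 | h1
  · rw [h0, zero_mul, sub_zero] at key
    have hsq : (x + 1) ^ 2 = 0 := by
      have : (x + 1) ^ 2 = x ^ 2 + 1 + 2 * x := by ring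
      rw [this, key, two_eq_zero_resid, zero_mul, add_zero]
    have hx1 : x + 1 = 0 := pow_eq_zero_iff (by norm_num) |>.1 hsq
    have hx' : x = 1 := by
      have := eq_neg_of_add_eq_zero_left hx1
      rw [this, neg_eq_self_resid]
    rw [hx', one_pow]
  · rw [h1, one_mul] at key
    have h3 : x ^ 3 + 1 = (x + 1) * (x ^ 2 - x + 1) := by ring
    rw [key, mul_zero] at h3
    rw [eq_neg_of_add_eq_zero_left h3, neg_eq_self_resid]

omit [Algebra.IsAlgebraic ℚ_[2] Ω] in
/-- For a `q`-step, `u + τu` and `u·τu` lie in `V₈`. -/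
theorem LocalData23.Frame.tau_data_of_stepsQ {q : ℚ_[2]} {u : Ω} (hu : u ∈ F.stepsQ q) :
    D.InV8 (u + D.τ u) ∧ D.InV8 (u * D.τ u) := by
  obtain ⟨a, b, c, d, e, f, g, h, hu_eq, -⟩ := hu
  set A := algebraMap ℚ_[2] Ω a + algebraMap ℚ_[2] Ω b * F.g₁ with hA
  set B := algebraMap ℚ_[2] Ω c + algebraMap ℚ_[2] Ω d * F.g₁ with hB
  set C := algebraMap ℚ_[2] Ω e + algebraMap ℚ_[2] Ω f * F.g₁ with hC
  set E := algebraMap ℚ_[2] Ω g + algebraMap ℚ_[2] Ω h * F.g₁ with hE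
  have hpairV : ∀ x y : ℚ_[2], D.InV8 (algebraMap ℚ_[2] Ω x + algebraMap ℚ_[2] Ω y * F.g₁) := by
    intro x y
    have hx : D.InV8 (algebraMap ℚ_[2] Ω x) := by
      have := D.inV8_pair x 0
      rwa [map_zero, zero_mul, add_zero] at this
    have hy : D.InV8 (algebraMap ℚ_[2] Ω y) := by
      have := D.inV8_pair y 0
      rwa [map_zero, zero_mul, add_zero] at this
    exact hx.add (hy.mul F.g₁_inV8)
  have hAv : D.InV8 A := hpairV a b
  have hBv : D.InV8 B := hpairV c d
  have hCv : D.InV8 C := hpairV e f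
  have hEv : D.InV8 E := hpairV g h
  have hcv : D.InV8 (algebraMap ℚ_[2] Ω F.c₂) := by
    have := D.inV8_pair F.c₂ 0
    rwa [map_zero, zero_mul, add_zero] at this
  have hτu : D.τ u = (A - B * F.g₂) + D.I * (C - E * F.g₂) := by
    rw [hu_eq]
    simp only [hA, hB, hC, hE, map_add, map_mul, AlgEquiv.commutes, D.τI, F.τg₁, F.τg₂]
    ring
  have hT_eq : u + D.τ u = (A + A) + D.I * (C + C) := by rw [hτu, hu_eq]; ring
  have hN_eq : u * D.τ u = (A * A - algebraMap ℚ_[2] Ω F.c₂ * (B * B)) +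
      D.I * ((A * C + A * C) - algebraMap ℚ_[2] Ω F.c₂ * (B * E + B * E)) +
      D.I * D.I * (C * C - algebraMap ℚ_[2] Ω F.c₂ * (E * E)) := by
    rw [hτu, hu_eq]; linear_combination (-(B ^ 2) - 2 * D.I * B * E - D.I ^ 2 * E ^ 2) * F.g₂_sq
  refine ⟨?_, ?_⟩
  · rw [hT_eq]; exact (hAv.add hAv).add (D.inV8_I.mul (hCv.add hCv))
  · rw [hN_eq]
    exact (((hAv.mul hAv).sub (hcv.mul (hBv.mul hBv))).add
      (D.inV8_I.mul (((hAv.mul hCv).add (hAv.mul hCv)).sub (hcv.mul ((hBv.mul hEv).add (hBv.mul hEv)))))).add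
      ((D.inV8_I.mul D.inV8_I).mul ((hCv.mul hCv).sub (hcv.mul (hEv.mul hEv))))

/-- The residue of a `q`-step (`‖q‖ = 1`) is a cube root of unity. -/
theorem LocalData23.Frame.resid_stepQ_cube {q : ℚ_[2]} (hq : ‖q‖ = 1) {u : Ω} (hu : u ∈ F.stepsQ q) :
    resid ℚ_[2] Ω ⟨u, by rw [mem_ball_iff, F.spN_stepQ hq hu]⟩ ^ 3 = 1 :=
  cube_of_tau_data (F.spN_stepQ hq hu) (F.tau_data_of_stepsQ hu).1 (F.tau_data_of_stepsQ hu).2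

/-- FOUR COLOURS with all `q`-steps at once. -/
theorem LocalData23.Frame.colorable_four_stepsQ {V : Type*} {G : SimpleGraph V} (z : V → Ω)
    (hz : ∀ ⦃v w : V⦄, G.Adj v w → ∃ q : ℚ_[2], ‖q‖ = 1 ∧ z v - z w ∈ F.stepsQ q) : G.Colorable 4 := by
  refine colorable_four_of_cube_steps {u | ∃ q : ℚ_[2], ‖q‖ = 1 ∧ u ∈ F.stepsQ q} ?_ ?_ z hz
  · rintro u ⟨q, hq, hu⟩; exact F.spN_stepQ hq hu
  · rintro u ⟨q, hq, hu⟩; exact F.resid_stepQ_cube hq hu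

omit [CharZero Ω] [Algebra.IsAlgebraic ℚ_[2] Ω] in
/-- `q ≡ 1` modulo the maximal ideal for every `2`-adic unit `q`. -/
theorem spN_algebraMap_sub_one_lt {q : ℚ_[2]} (hq : ‖q‖ = 1) : spN ℚ_[2] (algebraMap ℚ_[2] Ω q - 1) < 1 := by
  rw [← map_one (algebraMap ℚ_[2] Ω), ← map_sub, spN_algebraMap]
  exact norm_sub_one_lt_of_norm_eq_one hq

/-! ### Ramified frames: every `q`-step has residue one -/

section Ramified

variable (h3 : F.c₂ = -3)
include h3

omit [CharZero Ω] h3 in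
/-- Variant of `spN_sub_lt_imp` for `q`-steps: `u ≡ w`, `αw = w` ⇒ `‖q − w²‖ < 1`. -/
theorem LocalData23.Frame.spN_sub_lt_imp_Q {q : ℚ_[2]} (hq : ‖q‖ = 1) {u w : Ω} (hu : u ∈ F.stepsQ q) (hαw : F.α w = w)
    (hw : spN ℚ_[2] w ≤ 1) (hlt : spN ℚ_[2] (u - w) < 1) : spN ℚ_[2] (algebraMap ℚ_[2] Ω q - w ^ 2) < 1 := by
  have hprod := F.mul_α_of_stepsQ hu
  have hnu := F.spN_stepQ hq hu
  have hα : spN ℚ_[2] (F.α u - w) < 1 := by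
    have : F.α u - w = F.α (u - w) := by rw [map_sub, hαw]
    rw [this, spN_aut]; exact hlt
  have hid : algebraMap ℚ_[2] Ω q - w ^ 2 = u * (F.α u - w) + w * (u - w) := by rw [← hprod]; ring
  rw [hid]
  refine (spN_add_le ℚ_[2] _ _).trans_lt (max_lt ?_ ?_)
  · rw [spN_mul, hnu, one_mul]; exact hα
  · rw [spN_mul]
    calc spN ℚ_[2] w * spN ℚ_[2] (u - w) ≤ 1 * spN ℚ_[2] (u - w) :=
          mul_le_mul_of_nonneg_right hw (spN_nonneg ℚ_[2] _)
      _ < 1 := by rw [one_mul]; exact hlt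

/-- MAIN LOCAL LEMMA (ramified, many distances): every `q`-step, `‖q‖ = 1`, has residue `1`. -/
theorem LocalData23.Frame.resid_stepQ_eq_one {q : ℚ_[2]} (hq : ‖q‖ = 1) {u : Ω} (hu : u ∈ F.stepsQ q) :
    resid ℚ_[2] Ω ⟨u, by rw [mem_ball_iff, F.spN_stepQ hq hu]⟩ = 1 := by
  have hθ1 := F.spN_theta h3
  have h11 : (1 : Resid ℚ_[2] Ω) + 1 = 0 := by rw [← two_mul, mul_one]; exact two_eq_zero_resid
  have humem : u ∈ ball ℚ_[2] Ω := by rw [mem_ball_iff, F.spN_stepQ hq hu]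
  -- the residue of `q` is `1`
  have hqmem : algebraMap ℚ_[2] Ω q ∈ ball ℚ_[2] Ω := by rw [mem_ball_iff, spN_algebraMap, hq]
  have hq1 : resid ℚ_[2] Ω ⟨algebraMap ℚ_[2] Ω q, hqmem⟩ = 1 := by
    rw [← map_one (resid ℚ_[2] Ω), resid_eq_iff]; exact spN_algebraMap_sub_one_lt hq
  rcases F.eq_of_cube_eq_one h3 (F.resid_stepQ_cube hq hu) with h1 | hθ | hθ2
  · exact h1
  · exfalso
    have hlt : spN ℚ_[2] (u - F.theta) < 1 := (resid_eq_iff ℚ_[2] ⟨u, humem⟩ (F.thetaB h3)).1 hθ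
    have h := F.spN_sub_lt_imp_Q hq hu F.α_theta hθ1.le hlt
    have hmem : algebraMap ℚ_[2] Ω q - F.theta ^ 2 ∈ ball ℚ_[2] Ω := le_of_lt h
    have hres : resid ℚ_[2] Ω ⟨_, hmem⟩ = 0 := (resid_eq_zero_iff ℚ_[2] _).2 h
    have : (⟨algebraMap ℚ_[2] Ω q - F.theta ^ 2, hmem⟩ : ball ℚ_[2] Ω) =
        ⟨algebraMap ℚ_[2] Ω q, hqmem⟩ - (F.thetaB h3) ^ 2 := Subtype.ext rfl
    rw [this, map_sub, hq1, map_pow, F.resid_theta_sq h3, sub_eq_zero] at hres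
    have : resid ℚ_[2] Ω (F.thetaB h3) = 0 := by
      calc resid ℚ_[2] Ω (F.thetaB h3) = (resid ℚ_[2] Ω (F.thetaB h3) + 1) + 1 := by rw [add_assoc, h11, add_zero]
        _ = 1 + 1 := by rw [← hres]
        _ = 0 := h11
    exact F.resid_theta_ne_zero h3 this
  · exfalso
    have hθ2mem : F.theta ^ 2 ∈ ball ℚ_[2] Ω := (ball ℚ_[2] Ω).pow_mem (F.theta_mem_ball h3) 2
    have hb : (F.thetaB h3) ^ 2 = ⟨F.theta ^ 2, hθ2mem⟩ := Subtype.ext rfl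
    have hlt : spN ℚ_[2] (u - F.theta ^ 2) < 1 := by
      rw [← map_pow, hb] at hθ2
      exact (resid_eq_iff ℚ_[2] ⟨u, humem⟩ ⟨F.theta ^ 2, hθ2mem⟩).1 hθ2
    have hα2 : F.α (F.theta ^ 2) = F.theta ^ 2 := by rw [map_pow, F.α_theta]
    have hn2 : spN ℚ_[2] (F.theta ^ 2) ≤ 1 := by rw [spN_pow, hθ1, one_pow]
    have h := F.spN_sub_lt_imp_Q hq hu hα2 hn2 hlt
    have hmem : algebraMap ℚ_[2] Ω q - (F.theta ^ 2) ^ 2 ∈ ball ℚ_[2] Ω := le_of_lt h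
    have hres : resid ℚ_[2] Ω ⟨_, hmem⟩ = 0 := (resid_eq_zero_iff ℚ_[2] _).2 h
    have : (⟨algebraMap ℚ_[2] Ω q - (F.theta ^ 2) ^ 2, hmem⟩ : ball ℚ_[2] Ω) =
        ⟨algebraMap ℚ_[2] Ω q, hqmem⟩ - ((F.thetaB h3) ^ 2) ^ 2 := Subtype.ext rfl
    rw [this, map_sub, hq1, map_pow, map_pow, F.resid_theta_sq h3, sub_eq_zero] at hres
    have hsq : (resid ℚ_[2] Ω (F.thetaB h3) + 1) ^ 2 = resid ℚ_[2] Ω (F.thetaB h3) := by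
      rw [add_sq_resid, one_pow, F.resid_theta_sq h3, add_assoc, h11, add_zero]
    rw [hsq] at hres
    exact F.resid_theta_ne_one h3 hres.symm

/-- TWO COLOURS with all `q`-steps at once (ramified frames). -/
theorem LocalData23.Frame.colorable_two_stepsQ {V : Type*} {G : SimpleGraph V} (z : V → Ω)
    (hz : ∀ ⦃v w : V⦄, G.Adj v w → ∃ q : ℚ_[2], ‖q‖ = 1 ∧ z v - z w ∈ F.stepsQ q) : G.Colorable 2 := by
  refine colorable_two_of_one_steps {u | ∃ q : ℚ_[2], ‖q‖ = 1 ∧ u ∈ F.stepsQ q} ?_ ?_ z hz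
  · rintro u ⟨q, hq, hu⟩; exact F.spN_stepQ hq hu
  · rintro u ⟨q, hq, hu⟩; exact F.resid_stepQ_eq_one h3 hq hu

end Ramified

end MoserLocal

/-! ## Global statements: odd-square distances in multiquadratic planes -/

open MoserLocal SimpleGraph IntermediateField
open scoped IntermediateField

/-- The norm of a rational `2`-adic unit: `‖(r : ℚ₂)‖ = 1` iff … — we simply take `‖(r : ℚ_[2])‖ = 1` as the hypothesis
("`r` has odd numerator and odd denominator"); e.g. every odd natural number. -/
theorem norm_ratCast_two_eq_one_of_odd (n : ℕ) (hn : n % 2 = 1) : ‖((n : ℚ) : ℚ_[2])‖ = 1 := by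
  rw [Rat.cast_natCast]
  have hle : ‖((n : ℤ) : ℚ_[2])‖ ≤ 1 := Padic.norm_int_le_one _
  have hlt : ¬ ‖((n : ℤ) : ℚ_[2])‖ < 1 := by
    rw [Padic.norm_intCast_lt_one_iff]; omega
  rw [Int.cast_natCast] at hle hlt
  exact le_antisymm hle (not_lt.1 hlt)

/-- GENERAL REDUCTION (many distances).  `K ⊆ ℝ` with a ring map into `ℚ₂(g₁, g₂)` of a frame `F`; a graph with
`K`-coordinates in which adjacent vertices are at squared distance `r ∈ ℚ` with `‖r‖₂ = 1` (depending on the edge) is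
`4`-colourable, and `2`-colourable if the frame is ramified. -/
theorem colorable_of_embedding_frame_oddSq (K : IntermediateField ℚ ℝ) {D : LocalData23 Ω₂} (F : D.Frame) {c₁ : ℚ_[2]}
    (hg₁ : F.g₁ ^ 2 = algebraMap ℚ_[2] Ω₂ c₁) (φ : K →+* Ω₂) (hφ : ∀ t, φ t ∈ ℚ_[2]⟮F.g₁, F.g₂⟯)
    {V : Type*} {G : SimpleGraph V} (x y : V → K)
    (hadj : ∀ ⦃v w : V⦄, G.Adj v w → ∃ r : ℚ, ‖(r : ℚ_[2])‖ = 1 ∧ (x v - x w) ^ 2 + (y v - y w) ^ 2 = (r : K)) :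
    G.Colorable 4 ∧ (F.c₂ = -3 → G.Colorable 2) := by
  let z : V → Ω₂ := fun v => φ (x v) + D.I * φ (y v)
  have hz : ∀ ⦃v w : V⦄, G.Adj v w → ∃ q : ℚ_[2], ‖q‖ = 1 ∧ z v - z w ∈ F.stepsQ q := by
    intro v w hvw
    obtain ⟨r, hr, hsum⟩ := hadj hvw
    obtain ⟨a, b, c, d, hX⟩ := exists_coeffs_of_mem_adjoin_pair hg₁ F.g₂_sq (hφ (x v - x w))
    obtain ⟨e, f, g, h, hY⟩ := exists_coeffs_of_mem_adjoin_pair hg₁ F.g₂_sq (hφ (y v - y w))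
    refine ⟨(r : ℚ_[2]), hr, a, b, c, d, e, f, g, h, ?_, ?_⟩
    · change (φ (x v) + D.I * φ (y v)) - (φ (x w) + D.I * φ (y w)) = _
      rw [← hX, ← hY, map_sub, map_sub]; ring
    · rw [← hX, ← hY, ← map_pow, ← map_pow, ← map_add, hsum, map_ratCast, map_ratCast]
  exact ⟨F.colorable_four_stepsQ z hz, fun h3 => F.colorable_two_stepsQ h3 z hz⟩

/-- FOUR COLOURS FORBID ALL ODD-SQUARE DISTANCES: if the 2-adic square classes of `S` avoid `[−1]` (patterns `⟨[−2],[3]⟩`,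
`⟨[2],[5]⟩`, `⟨[−2],[5]⟩` of this seat; `⟨[2],[3]⟩` follows in the same way from `frame23`), every graph with
`ℚ(√d : d ∈ S)`-coordinates whose edges have squared lengths `r ∈ ℚ`, `‖r‖₂ = 1`, is `4`-colourable. -/
theorem colorable_four_of_oddSquareDistances (S : Finset ℕ) (hS : SquareClassesAvoidNegOne S)
    {V : Type*} {G : SimpleGraph V} (x y : V → multiSqrtField S)
    (hadj : ∀ ⦃v w : V⦄, G.Adj v w → ∃ r : ℚ, ‖(r : ℚ_[2])‖ = 1 ∧ (x v - x w) ^ 2 + (y v - y w) ^ 2 = (r : multiSqrtField S)) :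
    G.Colorable 4 := by
  rcases hS with h | h | h | h
  · exact (colorable_of_embedding_frame_oddSq (multiSqrtField S) fullLocalData₂.frame23 fullLocalData₂.g₁_sq.1
      (multiSqrtEmbed S : multiSqrtField S →ₐ[ℚ] Ω₂).toRingHom
      (fun t => multiSqrtEmbed_mem_of_roots S (multiSqrtEmbed S) _
        (fun d hd => exists_sq_eq_in_adjoin_sqrt2_sqrt3 fullLocalData₂.toLocalData23 d (h d hd)) t) x y hadj).1
  · exact (colorable_of_embedding_frame_oddSq (multiSqrtField S) fullLocalData₂.framem23 fullLocalData₂.g₁_sq.2.2.1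
      (multiSqrtEmbed S : multiSqrtField S →ₐ[ℚ] Ω₂).toRingHom
      (fun t => multiSqrtEmbed_mem_of_roots S (multiSqrtEmbed S) _
        (fun d hd => exists_sq_eq_framem23 fullLocalData₂ d (h d hd)) t) x y hadj).1
  · exact (colorable_of_embedding_frame_oddSq (multiSqrtField S) fullLocalData₂.frame2m3 fullLocalData₂.g₁_sq.2.1
      (multiSqrtEmbed S : multiSqrtField S →ₐ[ℚ] Ω₂).toRingHom
      (fun t => multiSqrtEmbed_mem_of_roots S (multiSqrtEmbed S) _
        (fun d hd => exists_sq_eq_frame2m3 fullLocalData₂ d (h d hd)) t) x y hadj).1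
  · exact (colorable_of_embedding_frame_oddSq (multiSqrtField S) fullLocalData₂.framem2m3 fullLocalData₂.g₁_sq.2.2.2
      (multiSqrtEmbed S : multiSqrtField S →ₐ[ℚ] Ω₂).toRingHom
      (fun t => multiSqrtEmbed_mem_of_roots S (multiSqrtEmbed S) _
        (fun d hd => exists_sq_eq_framem2m3 fullLocalData₂ d (h d hd)) t) x y hadj).1

/-- TWO COLOURS FORBID ALL ODD-SQUARE DISTANCES (ramified patterns): if `S` fits `⟨[2],[5]⟩` or `⟨[−2],[5]⟩`, every graph
with `ℚ(√d : d ∈ S)`-coordinates whose edges have squared lengths `r ∈ ℚ` with `‖r‖₂ = 1` is BIPARTITE — one `2`-colouring of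
`K_S²` forbids every distance `√r` (`r = 1, 3, 5, 1/3, 5/7, 9, …`) at once.  `S = ∅`: the rational plane. -/
theorem colorable_two_of_oddSquareDistances (S : Finset ℕ) (hS : SquareClassesAvoidNegOneAndThree S)
    {V : Type*} {G : SimpleGraph V} (x y : V → multiSqrtField S)
    (hadj : ∀ ⦃v w : V⦄, G.Adj v w → ∃ r : ℚ, ‖(r : ℚ_[2])‖ = 1 ∧ (x v - x w) ^ 2 + (y v - y w) ^ 2 = (r : multiSqrtField S)) :
    G.Colorable 2 := by
  rcases hS with h | h
  · exact (colorable_of_embedding_frame_oddSq (multiSqrtField S) fullLocalData₂.frame2m3 fullLocalData₂.g₁_sq.2.1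
      (multiSqrtEmbed S : multiSqrtField S →ₐ[ℚ] Ω₂).toRingHom
      (fun t => multiSqrtEmbed_mem_of_roots S (multiSqrtEmbed S) _
        (fun d hd => exists_sq_eq_frame2m3 fullLocalData₂ d (h d hd)) t) x y hadj).2 rfl
  · exact (colorable_of_embedding_frame_oddSq (multiSqrtField S) fullLocalData₂.framem2m3 fullLocalData₂.g₁_sq.2.2.2
      (multiSqrtEmbed S : multiSqrtField S →ₐ[ℚ] Ω₂).toRingHom
      (fun t => multiSqrtEmbed_mem_of_roots S (multiSqrtEmbed S) _
        (fun d hd => exists_sq_eq_framem2m3 fullLocalData₂ d (h d hd)) t) x y hadj).2 rfl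

/-- The ODD-SQUARE-DISTANCE GRAPH of `K²`: `p ~ q` iff `p ≠ q` and `dist(p,q)² = r` for some `r ∈ ℚ` with `‖r‖₂ = 1`. -/
def oddSqDistGraph (K : IntermediateField ℚ ℝ) : SimpleGraph (fieldPoints K) where
  Adj p q := p ≠ q ∧ ∃ r : ℚ, ‖(r : ℚ_[2])‖ = 1 ∧ dist (p : EuclideanSpace ℝ (Fin 2)) q ^ 2 = r
  symm := ⟨fun p q hpq => by
    obtain ⟨hne, r, hr, h⟩ := hpq
    exact ⟨hne.symm, r, hr, by rw [dist_comm]; exact h⟩⟩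
  loopless := ⟨fun p h => h.1 rfl⟩

/-- The odd-square-distance graph contains the unit-distance graph. -/
theorem unitDistance_le_oddSqDistGraph (K : IntermediateField ℚ ℝ) :
    planeUnitDistanceGraph.induce (fieldPoints K) ≤ oddSqDistGraph K := by
  intro p q h
  have h1 : dist (p : EuclideanSpace ℝ (Fin 2)) q = 1 := h
  refine ⟨fun hpq => ?_, 1, by simp, by rw [h1]; norm_num⟩
  rw [hpq, dist_self] at h1
  exact zero_ne_one h1

/-- MANY DISTANCES, plane form: for `S` in a ramified 2-adic pattern the odd-square-distance graph of `K_S²` is BIPARTITE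
(and its chromatic number is exactly `2`). -/
theorem chromaticNumber_oddSqDistGraph_eq_two (S : Finset ℕ) (hS : SquareClassesAvoidNegOneAndThree S) :
    (oddSqDistGraph (multiSqrtField S)).chromaticNumber = 2 := by
  rw [show (2 : ℕ∞) = (1 : ℕ) + 1 by norm_num]
  refine chromaticNumber_eq_iff_colorable_not_colorable.mpr ⟨?_, fun h => not_colorable_one_plane _
    (h.mono_left (unitDistance_le_oddSqDistGraph _))⟩
  refine colorable_two_of_oddSquareDistances S hS (G := oddSqDistGraph (multiSqrtField S))
    (fun p => ⟨(p : EuclideanSpace ℝ (Fin 2)) 0, p.2 0⟩) (fun p => ⟨(p : EuclideanSpace ℝ (Fin 2)) 1, p.2 1⟩) ?_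
  rintro p q ⟨-, r, hr, h⟩
  refine ⟨r, hr, Subtype.ext ?_⟩
  push_cast
  rw [← h, EuclideanSpace.dist_sq_eq, Fin.sum_univ_two, Real.dist_eq, Real.dist_eq, sq_abs, sq_abs]

/-- …and for every `[−1]`-free `S` it is `4`-colourable. -/
theorem colorable_four_oddSqDistGraph (S : Finset ℕ) (hS : SquareClassesAvoidNegOne S) :
    (oddSqDistGraph (multiSqrtField S)).Colorable 4 := by
  refine colorable_four_of_oddSquareDistances S hS (G := oddSqDistGraph (multiSqrtField S))
    (fun p => ⟨(p : EuclideanSpace ℝ (Fin 2)) 0, p.2 0⟩) (fun p => ⟨(p : EuclideanSpace ℝ (Fin 2)) 1, p.2 1⟩) ?_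
  rintro p q ⟨-, r, hr, h⟩
  refine ⟨r, hr, Subtype.ext ?_⟩
  push_cast
  rw [← h, EuclideanSpace.dist_sq_eq, Fin.sum_univ_two, Real.dist_eq, Real.dist_eq, sq_abs, sq_abs]

/-- WOODALL-TYPE COROLLARY: the rational plane `ℚ²` has a `2`-colouring forbidding simultaneously every distance `√r`,
`r ∈ ℚ_{>0}` with odd numerator and denominator (kernel; `S = ∅`). -/
theorem chromaticNumber_oddSqDistGraph_rat : (oddSqDistGraph (multiSqrtField ∅)).chromaticNumber = 2 :=
  chromaticNumber_oddSqDistGraph_eq_two ∅ (by decide)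

end Summit.Ventures.DiscreteObjects.UnitDistance
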